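import Literature.AlgebraicGeometry.Smoothening.ConormalBaseChange
import Literature.AlgebraicGeometry.Smoothening.NeronDefect
import HarnessLib

/-!
# Fibres of the differentials at an `L`-valued point, functorially

Topic: `Literature/AlgebraicGeometry/Smoothening`. For a ring map `R → X` and an `X`-algebra
`L` (a point of `Spec X` with values in `L`, typically a field), the *fibre of the
differentials at the point* is the `L`-module `L ⊗_X Ω[X⁄R]`. For `X → Y` compatible with the
points, `fibreMap R X Y L : L ⊗_X Ω[X⁄R] → L ⊗_Y Ω[Y⁄R]`, `l ⊗ ω ↦ l ⊗ dω`, is functorial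
(`fibreMap_comp`), bijective when `Y` is a localization of `X`
(`fibreMap_bijective_of_isLocalization`: differentials commute with localization), and for a
quotient `Y = X/J` it is the naive map `L ⊗_X Ω[X⁄R] → L ⊗_X Ω[(X/J)⁄R]` followed by the
identification `L ⊗_X – = L ⊗_{X/J} –` (`fibreMap_quotient`). Consequence
(`injective_fibreMap_iff_of_isLocalization`): injectivity of the fibre map for a pair
`(X, X/J)` is equivalent to injectivity for a localized pair `(X', X'/JX')` through which the
point factors — the reduction used to localize the conormal criterion of Görtz–Wedhorn II,
Thm. 18.74 (`ConormalLocalization`). Folklore linear algebra of Kähler differentials; no named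
facts are introduced (D-0026).

## References

* U. Görtz, T. Wedhorn, *Algebraic Geometry II*, Springer Spektrum 2023, Thm. 18.74
  (PDF p. 106). [GortzWedhorn2023]
-/

noncomputable section

open scoped TensorProduct
open Algebra KaehlerDifferential

namespace Literature.AlgebraicGeometry.Smoothening

universe u

/-! ### `map` is functorial -/

section MapMap

variable (R : Type u) [CommRing R] (X : Type u) [CommRing X] [Algebra R X]
  (Y : Type u) [CommRing Y] [Algebra R Y] [Algebra X Y] [IsScalarTower R X Y]
  (Z : Type u) [CommRing Z] [Algebra R Z] [Algebra X Z] [Algebra Y Z]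
  [IsScalarTower R X Z] [IsScalarTower R Y Z] [IsScalarTower X Y Z]

/-- `Ω[X⁄R] → Ω[Y⁄R] → Ω[Z⁄R]` is `Ω[X⁄R] → Ω[Z⁄R]` (both send `dx` to `d(x)`). [folklore] -/
theorem map_map (ω : Ω[X⁄R]) :
    KaehlerDifferential.map R R Y Z (KaehlerDifferential.map R R X Y ω) =
      KaehlerDifferential.map R R X Z ω := by
  have key : ((KaehlerDifferential.map R R Y Z).restrictScalars X) ∘ₗ
      KaehlerDifferential.map R R X Y = KaehlerDifferential.map R R X Z := by
    refine LinearMap.ext_on_range (KaehlerDifferential.span_range_derivation R X) fun x => ?_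
    simp only [LinearMap.comp_apply, LinearMap.restrictScalars_apply, KaehlerDifferential.map_D,
      ← IsScalarTower.algebraMap_apply]
  exact LinearMap.congr_fun key ω

end MapMap

/-! ### The fibre map -/

section FibreMap

variable (R : Type u) [CommRing R] (X : Type u) [CommRing X] [Algebra R X]
  (Y : Type u) [CommRing Y] [Algebra R Y] [Algebra X Y] [IsScalarTower R X Y]
  (L : Type u) [CommRing L] [Algebra X L] [Algebra Y L] [IsScalarTower X Y L]

/-- **The fibre map of the differentials** along `X → Y` at an `L`-valued point:
`L ⊗_X Ω[X⁄R] → L ⊗_Y Ω[Y⁄R]`, `l ⊗ ω ↦ l ⊗ dω`. [folklore] -/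
def fibreMap : L ⊗[X] Ω[X⁄R] →ₗ[L] L ⊗[Y] Ω[Y⁄R] :=
  TensorProduct.AlgebraTensorModule.lift
    { toFun := fun l =>
        { toFun := fun ω => l ⊗ₜ[Y] KaehlerDifferential.map R R X Y ω
          map_add' := fun ω₁ ω₂ => by rw [map_add, TensorProduct.tmul_add]
          map_smul' := fun x ω => by
            rw [LinearMap.map_smul_of_tower, RingHom.id_apply, ← algebraMap_smul Y x,
              TensorProduct.tmul_smul, algebraMap_smul] }
      map_add' := fun l₁ l₂ => by
        ext ω
        exact TensorProduct.add_tmul l₁ l₂ _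
      map_smul' := fun c l => by
        ext ω
        simp only [LinearMap.coe_mk, AddHom.coe_mk, RingHom.id_apply, LinearMap.smul_apply,
          TensorProduct.smul_tmul', smul_eq_mul] }

/-- The fibre map on pure tensors. [folklore] -/
@[simp]
theorem fibreMap_tmul (l : L) (ω : Ω[X⁄R]) :
    fibreMap R X Y L (l ⊗ₜ[X] ω) = l ⊗ₜ[Y] KaehlerDifferential.map R R X Y ω :=
  rfl

/-- Extensionality for `L`-linear maps out of a fibre `L ⊗_X Ω[X⁄R]`: it suffices to agree on
the `l ⊗ dx`. [folklore] -/
theorem fibre_ext {M : Type u} [AddCommGroup M] [Module L M] {F G : L ⊗[X] Ω[X⁄R] →ₗ[L] M}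
    (h : ∀ (l : L) (x : X), F (l ⊗ₜ D R X x) = G (l ⊗ₜ D R X x)) : F = G := by
  refine LinearMap.ext fun z => ?_
  induction z using TensorProduct.induction_on with
  | zero => rw [map_zero, map_zero]
  | add a b ha hb => rw [map_add, map_add, ha, hb]
  | tmul l ω => ?_
  revert l
  have hω : ω ∈ Submodule.span X (Set.range (D R X)) := by
    rw [KaehlerDifferential.span_range_derivation]; trivial
  refine Submodule.span_induction (p := fun ω _ => ∀ l : L, F (l ⊗ₜ[X] ω) = G (l ⊗ₜ[X] ω))
    ?_ ?_ ?_ ?_ hω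
  · rintro _ ⟨x, rfl⟩ l
    exact h l x
  · intro l
    rw [TensorProduct.tmul_zero, map_zero, map_zero]
  · intro ω₁ ω₂ _ _ h₁ h₂ l
    rw [TensorProduct.tmul_add, map_add, map_add, h₁, h₂]
  · intro x ω _ hx l
    rw [← TensorProduct.smul_tmul]
    exact hx (x • l)

/-- **Functoriality**: the fibre map of `X → Y → Z` is the composite. [folklore] -/
theorem fibreMap_comp (Z : Type u) [CommRing Z] [Algebra R Z] [Algebra X Z] [Algebra Y Z]
    [IsScalarTower R X Z] [IsScalarTower R Y Z] [IsScalarTower X Y Z] [Algebra Z L]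
    [IsScalarTower X Z L] [IsScalarTower Y Z L] :
    fibreMap R Y Z L ∘ₗ fibreMap R X Y L = fibreMap R X Z L := by
  refine TensorProduct.AlgebraTensorModule.ext fun l ω => ?_
  simp only [LinearMap.comp_apply, fibreMap_tmul, map_map]

/-- The fibre map of the identity is the identity. [folklore] -/
theorem fibreMap_self : fibreMap R X X L = LinearMap.id := by
  refine TensorProduct.AlgebraTensorModule.ext fun l ω => ?_
  simp only [fibreMap_tmul, LinearMap.id_apply]
  congr 1
  have key : KaehlerDifferential.map R R X X = LinearMap.id := by
    refine LinearMap.ext_on_range (KaehlerDifferential.span_range_derivation R X) fun x => ?_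
    rw [KaehlerDifferential.map_D, LinearMap.id_apply]
    rfl
  exact LinearMap.congr_fun key ω

end FibreMap

/-! ### Localizations and quotients -/

section Special

variable (R : Type u) [CommRing R] (X : Type u) [CommRing X] [Algebra R X]
  (Y : Type u) [CommRing Y] [Algebra R Y] [Algebra X Y] [IsScalarTower R X Y]
  (L : Type u) [CommRing L] [Algebra X L] [Algebra Y L] [IsScalarTower X Y L]

/-- **Along a localization the fibre map is the isomorphism
`tensorKaehlerEquivOfIsLocalization`** (differentials commute with localization). [folklore] -/
theorem fibreMap_eq_tensorKaehlerEquivOfIsLocalization (M : Submonoid X) [IsLocalization M Y] :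
    fibreMap R X Y L = (tensorKaehlerEquivOfIsLocalization R X Y M L).toLinearMap := by
  refine fibre_ext R X L fun l x => ?_
  rw [fibreMap_tmul, KaehlerDifferential.map_D]
  -- unfold the equivalence on a pure tensor
  change _ = (TensorProduct.AlgebraTensorModule.congr (LinearEquiv.refl L L)
    ((IsLocalizedModule.isBaseChange M Y (KaehlerDifferential.map R R X Y)).equiv))
      ((TensorProduct.AlgebraTensorModule.cancelBaseChange X Y L L Ω[X⁄R]).symm (l ⊗ₜ[X] D R X x))
  rw [TensorProduct.AlgebraTensorModule.cancelBaseChange_symm_tmul,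
    TensorProduct.AlgebraTensorModule.congr_tmul, LinearEquiv.refl_apply,
    IsBaseChange.equiv_tmul, one_smul, KaehlerDifferential.map_D]

/-- Along a localization the fibre map is bijective. [folklore] -/
theorem fibreMap_bijective_of_isLocalization (M : Submonoid X) [IsLocalization M Y] :
    Function.Bijective (fibreMap R X Y L) := by
  rw [fibreMap_eq_tensorKaehlerEquivOfIsLocalization R X Y L M]
  exact (tensorKaehlerEquivOfIsLocalization R X Y M L).bijective

/-- **Along a quotient `X → X/J` the fibre map is the naive map followed by
`L ⊗_X – = L ⊗_{X/J} –`.** [folklore] -/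
theorem fibreMap_quotient (J : Ideal X) [Algebra (X ⧸ J) L] [IsScalarTower X (X ⧸ J) L] :
    fibreMap R X (X ⧸ J) L =
      (tensorQuotientEquiv J L Ω[(X ⧸ J)⁄R]).toLinearMap ∘ₗ
        (KaehlerDifferential.map R R X (X ⧸ J)).baseChange L := by
  refine TensorProduct.AlgebraTensorModule.ext fun l ω => ?_
  simp only [fibreMap_tmul, LinearMap.comp_apply, LinearEquiv.coe_coe, LinearMap.baseChange_tmul,
    tensorQuotientEquiv_tmul]

/-- Hence injectivity of the fibre map along `X → X/J` is injectivity of the naive map. [folklore] -/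
theorem injective_fibreMap_quotient_iff (J : Ideal X) [Algebra (X ⧸ J) L]
    [IsScalarTower X (X ⧸ J) L] :
    Function.Injective (fibreMap R X (X ⧸ J) L) ↔
      Function.Injective ((KaehlerDifferential.map R R X (X ⧸ J)).baseChange L) := by
  rw [fibreMap_quotient]
  constructor
  · intro h
    have h' : Function.Injective (⇑(tensorQuotientEquiv J L Ω[(X ⧸ J)⁄R]) ∘
        ⇑((KaehlerDifferential.map R R X (X ⧸ J)).baseChange L)) := h
    exact Function.Injective.of_comp h'
  · intro h
    exact (tensorQuotientEquiv J L Ω[(X ⧸ J)⁄R]).injective.comp h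

end Special

/-! ### Injectivity is insensitive to localizing the pair -/

section Transfer

variable (R : Type u) [CommRing R]
  (X : Type u) [CommRing X] [Algebra R X] (Y : Type u) [CommRing Y] [Algebra R Y]
  (X' : Type u) [CommRing X'] [Algebra R X'] (Y' : Type u) [CommRing Y'] [Algebra R Y']
  [Algebra X Y] [IsScalarTower R X Y] [Algebra X X'] [IsScalarTower R X X']
  [Algebra X' Y'] [IsScalarTower R X' Y'] [Algebra Y Y'] [IsScalarTower R Y Y']
  [Algebra X Y'] [IsScalarTower R X Y'] [IsScalarTower X Y Y'] [IsScalarTower X X' Y']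
  (L : Type u) [CommRing L] [Algebra X L] [Algebra Y L] [Algebra X' L] [Algebra Y' L]
  [IsScalarTower X Y L] [IsScalarTower X X' L] [IsScalarTower X' Y' L] [IsScalarTower Y Y' L]
  [IsScalarTower X Y' L]

/-- **Injectivity of the fibre map is insensitive to localization**: for a commutative square
`X → Y, X → X', Y → Y', X' → Y'` of algebras over the point, with `X → X'` and `Y → Y'`
localizations, the fibre map of `X → Y` is injective iff that of `X' → Y'` is. [folklore] -/
theorem injective_fibreMap_iff_of_isLocalization (M : Submonoid X) [IsLocalization M X']
    (N : Submonoid Y) [IsLocalization N Y'] :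
    Function.Injective (fibreMap R X Y L) ↔ Function.Injective (fibreMap R X' Y' L) := by
  have h₁ : fibreMap R Y Y' L ∘ₗ fibreMap R X Y L = fibreMap R X Y' L := fibreMap_comp R X Y L Y'
  have h₂ : fibreMap R X' Y' L ∘ₗ fibreMap R X X' L = fibreMap R X Y' L := fibreMap_comp R X X' L Y'
  have eY := fibreMap_bijective_of_isLocalization R Y Y' L N
  have eX := fibreMap_bijective_of_isLocalization R X X' L M
  have key : ⇑(fibreMap R Y Y' L) ∘ ⇑(fibreMap R X Y L) = ⇑(fibreMap R X' Y' L) ∘ ⇑(fibreMap R X X' L) := by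
    have := congrArg (fun f : L ⊗[X] Ω[X⁄R] →ₗ[L] L ⊗[Y'] Ω[Y'⁄R] => ⇑f) (h₁.trans h₂.symm)
    simpa only [LinearMap.coe_comp] using this
  constructor
  · intro h
    have hc : Function.Injective (⇑(fibreMap R X' Y' L) ∘ ⇑(fibreMap R X X' L)) := by
      rw [← key]; exact eY.injective.comp h
    intro a b hab
    obtain ⟨a', rfl⟩ := eX.surjective a
    obtain ⟨b', rfl⟩ := eX.surjective b
    rw [hc hab]
  · intro h
    have hc : Function.Injective (⇑(fibreMap R Y Y' L) ∘ ⇑(fibreMap R X Y L)) := by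
      rw [key]; exact h.comp eX.injective
    exact Function.Injective.of_comp hc

end Transfer

end Literature.AlgebraicGeometry.Smoothening

end
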